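import Summits.CriticalPhenomena.PercolationContinuityZ3.Theorems.PercNearOneGluingNoHeavyLowerTailThreeSumCount
import Summits.CriticalPhenomena.PercolationContinuityZ3.Theorems.PercNearOneGluingNoHeavyLowerTailThreeSumGlue
import HarnessLib

/-!
# `NoHeavyLowerTail` (stmt-CriticalPhenomena-4575) — the 3-sum theorem for R1, measure level, part 3:
# the three-point cells of a glued configuration, pointwise (counts on the cells, tables of the join rule,
# the separating cell)

Support file (prover prim-gen-kcluster gen 71; `--supports stmt-CriticalPhenomena-4575`).  No definitions, no
named facts, no sorries.  Blueprint KCLUSTER-gen69.md §9 (N3b), steps (6)–(7), pointwise part.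

SETTING.  Finite vertex type `V`, distinct terminals `a b c`, edge supports `DA DB : Finset (Sym2 V)` MEETING
ONLY IN `{a,b,c}` (`hsepD`); a configuration `ω ⊆ DA ∪ DB` has the blocks `ζ_A = ω ∩ DA`, `ζ_B = ω ∖ DA`.
Three-point events of the instance `(a; b, c)` are written with the tree's clusters `Gladkov.cl` and the
support separation `RefinedRowR3.Sep` (as in `SepDual`, `RCFolding`): `abc = {b ∈ C(a), c ∈ C(a)}`,
`ab|c`, `ac|b`, `a|bc = {b ∉ C(a), c ∈ C(b)}`, `a|b|c`, and `S_D = {b, c ∉ C(a), C(a) meets every b–c path of D}`.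

* `ThreeSum.k_cell_T/Ub/Uc/N/apart` — on each cell the free cluster count is the `{a,b,c}`-wired count plus
  `(blocks − 1)` (`ThreeSum.clusterCount_empty_eq_wired_three`).
* `ThreeSum.kT_add` — inside the support, `k^T(ω) + k^T(∅) = k^T(ζ_A) + k^T(ζ_B)`
  (`ThreeSum.clusterCount_union_add_wired`).
* `ThreeSum.table_T/Ub/Uc/apart` — the Boolean tables of the join rule: the indicator of each glued cell is
  a bilinear form in the indicators of the piece cells (`abc`: 7 products incl. the total mass; `ab|c`,
  `ac|b`: 3 products; `a|b|c`: 1).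
* `ThreeSum.glued_atoms`, `ThreeSum.glued_atom_bc` — the join rule (`APL.glued_ab_iff/ac_iff/bc_iff`) for the blocks of `ω`, in event form;
  `ThreeSum.glued_S_iff` — the separating cell of the glued graph is the product of the pieces' separating
  cells (`ThreeSum.sep_union_iff`).
The identities of sums (cell masses of `φ_{𝐩,q}` of the glued graph as bilinear forms in the pieces'
`{a,b,c}`-wired cell masses) follow in part 4.
-/
noncomputable section

namespace Summit.CriticalPhenomena.PercolationContinuityZ3.Theorems

namespace ThreeSum

open Finset SimpleGraph Literature.Probability.Percolation Literature.Probability.Percolation.Gladkov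
open Literature.Probability.Percolation.BHK2006 (weight)
open Literature.Probability.Percolation.DecisionTree (ind ind_of_mem ind_of_not_mem)
open Literature.Probability.LatticeModels RefinedRowR3 ThreePointLB APL MeasureTheory
open scoped Classical

variable {V : Type*} [Fintype V]

/-! ### Cluster counts on the cells: free versus wired at `T = {a,b,c}` -/

section Shift

variable {a b c : V} (hab : a ≠ b) (hac : a ≠ c) (hbc : b ≠ c)
include hab hac hbc

/-- On the cell `abc`: `k(ω) = k^T(ω)`. [this work] -/
theorem k_cell_T (ω : BondConfig V) (hb : b ∈ cl ω.toFinset a) (hc : c ∈ cl ω.toFinset a) :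
    clusterCount ω ∅ = clusterCount ω ({a, b, c} : Set V) := by
  rw [mem_cl, Set.coe_toFinset] at hb hc
  have h := clusterCount_empty_eq_wired_three hab hac hbc ω
  rw [if_pos hb, if_pos (Or.inl hc)] at h
  omega

/-- On the cell `ab|c`: `k(ω) = k^T(ω) + 1`. [this work] -/
theorem k_cell_Ub (ω : BondConfig V) (hb : b ∈ cl ω.toFinset a) (hc : c ∉ cl ω.toFinset a) :
    clusterCount ω ∅ = clusterCount ω ({a, b, c} : Set V) + 1 := by
  rw [mem_cl, Set.coe_toFinset] at hb hc
  have hbc' : ¬ (openGraph ω).Reachable b c := fun h => hc (hb.trans h)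
  have h := clusterCount_empty_eq_wired_three hab hac hbc ω
  rw [if_pos hb, if_neg (not_or.2 ⟨hc, hbc'⟩)] at h
  omega

/-- On the cell `ac|b`: `k(ω) = k^T(ω) + 1`. [this work] -/
theorem k_cell_Uc (ω : BondConfig V) (hb : b ∉ cl ω.toFinset a) (hc : c ∈ cl ω.toFinset a) :
    clusterCount ω ∅ = clusterCount ω ({a, b, c} : Set V) + 1 := by
  rw [mem_cl, Set.coe_toFinset] at hb hc
  have h := clusterCount_empty_eq_wired_three hab hac hbc ω
  rw [if_neg hb, if_pos (Or.inl hc)] at h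
  omega

/-- On the cell `a|bc`: `k(ω) = k^T(ω) + 1`. [this work] -/
theorem k_cell_N (ω : BondConfig V) (hb : b ∉ cl ω.toFinset a) (hcb : c ∈ cl ω.toFinset b) :
    clusterCount ω ∅ = clusterCount ω ({a, b, c} : Set V) + 1 := by
  rw [mem_cl, Set.coe_toFinset] at hb hcb
  have h := clusterCount_empty_eq_wired_three hab hac hbc ω
  rw [if_neg hb, if_pos (Or.inr hcb)] at h
  omega

/-- On the cell `a|b|c`: `k(ω) = k^T(ω) + 2`. [this work] -/
theorem k_cell_apart (ω : BondConfig V) (hb : b ∉ cl ω.toFinset a) (hc : c ∉ cl ω.toFinset a)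
    (hcb : c ∉ cl ω.toFinset b) :
    clusterCount ω ∅ = clusterCount ω ({a, b, c} : Set V) + 2 := by
  rw [mem_cl, Set.coe_toFinset] at hb hc hcb
  have h := clusterCount_empty_eq_wired_three hab hac hbc ω
  rw [if_neg hb, if_neg (not_or.2 ⟨hc, hcb⟩)] at h
  omega

end Shift

/-! ### Pointwise decomposition of a glued configuration -/

section Pointwise

variable {DA DB : Finset (Sym2 V)} {a b c : V}

omit [Fintype V] in
/-- Membership in `Set.toFinset`, with the `Fintype` instance as an implicit (unifiable) argument. [folklore] -/
theorem mem_toFinset' {s : Set (Sym2 V)} {inst : Fintype ↥s} {e : Sym2 V} :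
    e ∈ @Set.toFinset _ s inst ↔ e ∈ s :=
  Set.mem_toFinset

/-- The two blocks of a configuration inside the glued support, as finite sets. [folklore] -/
theorem toFinset_blocks (ω : BondConfig V) :
    (ω ∩ (↑DA : Set (Sym2 V))).toFinset = ω.toFinset ∩ DA ∧
      (ω \ (↑DA : Set (Sym2 V))).toFinset = ω.toFinset \ DA ∧
      ω.toFinset = (ω ∩ (↑DA : Set (Sym2 V))).toFinset ∪ (ω \ (↑DA : Set (Sym2 V))).toFinset := by
  refine ⟨?_, ?_, ?_⟩
  · ext e; simp
  · ext e; simp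
  · ext e; simp only [Set.mem_toFinset, Finset.mem_union, Set.mem_inter_iff, Set.mem_sdiff, Finset.mem_coe]
    tauto

/-- Inside the glued support the `B`-block lies in `DB` and the blocks meet only in `{a,b,c}`. [this work] -/
theorem blocks_hsep
    (hsepD : ∀ v : V, (∃ e ∈ DA, v ∈ e) → (∃ e ∈ DB, v ∈ e) → (v = a ∨ v = b ∨ v = c))
    {ω : BondConfig V} (hω : ω ⊆ ↑DA ∪ ↑DB) :
    (ω ∩ (↑DA : Set (Sym2 V))).toFinset ⊆ DA ∧ (ω \ (↑DA : Set (Sym2 V))).toFinset ⊆ DB ∧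
      (∀ v : V, (∃ e ∈ (ω ∩ (↑DA : Set (Sym2 V))).toFinset, v ∈ e) →
        (∃ e ∈ (ω \ (↑DA : Set (Sym2 V))).toFinset, v ∈ e) → (v = a ∨ v = b ∨ v = c)) := by
  have hA : (ω ∩ (↑DA : Set (Sym2 V))).toFinset ⊆ DA := fun e he => by
    rw [Set.mem_toFinset] at he; exact he.2
  have hB : (ω \ (↑DA : Set (Sym2 V))).toFinset ⊆ DB := fun e he => by
    rw [Set.mem_toFinset] at he
    rcases hω he.1 with h | h
    · exact absurd h he.2
    · exact h
  exact ⟨hA, hB, fun v ⟨e, he, hve⟩ ⟨e', he', hve'⟩ => hsepD v ⟨e, hA he, hve⟩ ⟨e', hB he', hve'⟩⟩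

/-- A configuration not inside the support has weight zero. [folklore] -/
theorem weight_eq_zero_of_not_subset (w : Sym2 V → unitInterval) {D : Set (Sym2 V)}
    (hw : ∀ e ∉ D, (w e : ℝ) = 0) {ω : BondConfig V} (hω : ¬ ω ⊆ D) :
    weight (fun e => (w e : ℝ)) ω = 0 := by
  obtain ⟨e, heω, heD⟩ := Set.not_subset.1 hω
  unfold weight
  exact Finset.prod_eq_zero (Finset.mem_univ e) (by simp only [if_pos heω]; exact hw e heD)

variable (hsepD : ∀ v : V, (∃ e ∈ DA, v ∈ e) → (∃ e ∈ DB, v ∈ e) → (v = a ∨ v = b ∨ v = c))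
include hsepD

/-- **Wired cluster counts of a glued configuration add** (inside the support):
`k^T(ω) + k^T(∅) = k^T(ω ∩ DA) + k^T(ω ∖ DA)`. [this work] -/
theorem kT_add {ω : BondConfig V} (hω : ω ⊆ ↑DA ∪ ↑DB) :
    clusterCount ω ({a, b, c} : Set V) + clusterCount (∅ : BondConfig V) ({a, b, c} : Set V) =
      clusterCount (ω ∩ ↑DA) ({a, b, c} : Set V) + clusterCount (ω \ ↑DA) ({a, b, c} : Set V) := by
  obtain ⟨hA, hB, hsep⟩ := blocks_hsep hsepD hω
  have hmeet : ∀ e ∈ ω ∩ (↑DA : Set (Sym2 V)), ∀ e' ∈ ω \ (↑DA : Set (Sym2 V)), ∀ x, x ∈ e → x ∈ e' →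
      x ∈ ({a, b, c} : Set V) := by
    intro e he e' he' x hx hx'
    have h := hsep x ⟨e, by rw [Set.mem_toFinset]; exact he, hx⟩ ⟨e', by rw [Set.mem_toFinset]; exact he', hx'⟩
    simp only [Set.mem_insert_iff, Set.mem_singleton_iff]; exact h
  have key := clusterCount_union_add_wired (T := ({a, b, c} : Set V)) hmeet (Set.mem_insert a _)
  rwa [Set.inter_union_sdiff] at key

end Pointwise

/-! ### Boolean tables of the join rule -/

section Tables

variable {αA γA κA αB γB κB : Prop} {x cA bA gA nA zA cB bB gB nB zB : ℝ}

/-- Table of the cell `abc` of the glued graph.  Atoms of piece `P`: `α = a~b`, `γ = a~c`, `κ = b~c` (an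
equivalence relation inside the piece); indicator values `c_P = 1[α∧γ]`, `b_P = 1[α∧¬γ]`, `g_P = 1[¬α∧γ]`,
`n_P = 1[¬α∧¬γ∧κ]`; by the join rule the glued cell `abc` is `(α_A∨α_B∨((γ_A∨γ_B)∧(κ_A∨κ_B))) ∧ (γ…)`, and
`1[abc] = c_A + c_B − c_A c_B + n_A (b_B + g_B) + n_B (b_A + g_A) + b_A g_B + g_A b_B`. [this work] -/
theorem table_T (h1A : αA → γA → κA) (h2A : αA → κA → γA) (h3A : γA → κA → αA)
    (h1B : αB → γB → κB) (h2B : αB → κB → γB) (h3B : γB → κB → αB)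
    (hx1 : (((αA ∨ αB) ∨ ((γA ∨ γB) ∧ (κA ∨ κB))) ∧ ((γA ∨ γB) ∨ ((αA ∨ αB) ∧ (κA ∨ κB)))) → x = 1)
    (hx0 : ¬ (((αA ∨ αB) ∨ ((γA ∨ γB) ∧ (κA ∨ κB))) ∧ ((γA ∨ γB) ∨ ((αA ∨ αB) ∧ (κA ∨ κB)))) → x = 0)
    (hcA1 : (αA ∧ γA) → cA = 1) (hcA0 : ¬ (αA ∧ γA) → cA = 0)
    (hcB1 : (αB ∧ γB) → cB = 1) (hcB0 : ¬ (αB ∧ γB) → cB = 0)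
    (hbA1 : (αA ∧ ¬γA) → bA = 1) (hbA0 : ¬ (αA ∧ ¬γA) → bA = 0)
    (hbB1 : (αB ∧ ¬γB) → bB = 1) (hbB0 : ¬ (αB ∧ ¬γB) → bB = 0)
    (hgA1 : (¬αA ∧ γA) → gA = 1) (hgA0 : ¬ (¬αA ∧ γA) → gA = 0)
    (hgB1 : (¬αB ∧ γB) → gB = 1) (hgB0 : ¬ (¬αB ∧ γB) → gB = 0)
    (hnA1 : (¬αA ∧ ¬γA ∧ κA) → nA = 1) (hnA0 : ¬ (¬αA ∧ ¬γA ∧ κA) → nA = 0)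
    (hnB1 : (¬αB ∧ ¬γB ∧ κB) → nB = 1) (hnB0 : ¬ (¬αB ∧ ¬γB ∧ κB) → nB = 0) :
    x = cA + cB - cA * cB + nA * (bB + gB) + nB * (bA + gA) + bA * gB + gA * bB := by
  by_cases hαA : αA <;> by_cases hγA : γA <;> by_cases hκA : κA <;>
    by_cases hαB : αB <;> by_cases hγB : γB <;> by_cases hκB : κB <;> simp_all

/-- Table of the cell `ab|c` of the glued graph: with `z_P = 1[¬α∧¬γ∧¬κ]` (pairwise apart),
`1[ab|c] = b_A z_B + z_A b_B + b_A b_B`. [this work] -/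
theorem table_Ub (h1A : αA → γA → κA) (h2A : αA → κA → γA) (h3A : γA → κA → αA)
    (h1B : αB → γB → κB) (h2B : αB → κB → γB) (h3B : γB → κB → αB)
    (hx1 : (((αA ∨ αB) ∨ ((γA ∨ γB) ∧ (κA ∨ κB))) ∧ ¬ ((γA ∨ γB) ∨ ((αA ∨ αB) ∧ (κA ∨ κB)))) → x = 1)
    (hx0 : ¬ (((αA ∨ αB) ∨ ((γA ∨ γB) ∧ (κA ∨ κB))) ∧ ¬ ((γA ∨ γB) ∨ ((αA ∨ αB) ∧ (κA ∨ κB)))) → x = 0)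
    (hbA1 : (αA ∧ ¬γA) → bA = 1) (hbA0 : ¬ (αA ∧ ¬γA) → bA = 0)
    (hbB1 : (αB ∧ ¬γB) → bB = 1) (hbB0 : ¬ (αB ∧ ¬γB) → bB = 0)
    (hzA1 : (¬αA ∧ ¬γA ∧ ¬κA) → zA = 1) (hzA0 : ¬ (¬αA ∧ ¬γA ∧ ¬κA) → zA = 0)
    (hzB1 : (¬αB ∧ ¬γB ∧ ¬κB) → zB = 1) (hzB0 : ¬ (¬αB ∧ ¬γB ∧ ¬κB) → zB = 0) :
    x = bA * zB + zA * bB + bA * bB := by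
  by_cases hαA : αA <;> by_cases hγA : γA <;> by_cases hκA : κA <;>
    by_cases hαB : αB <;> by_cases hγB : γB <;> by_cases hκB : κB <;> simp_all

/-- Table of the cell `ac|b` of the glued graph: `1[ac|b] = g_A z_B + z_A g_B + g_A g_B`. [this work] -/
theorem table_Uc (h1A : αA → γA → κA) (h2A : αA → κA → γA) (h3A : γA → κA → αA)
    (h1B : αB → γB → κB) (h2B : αB → κB → γB) (h3B : γB → κB → αB)
    (hx1 : (¬ ((αA ∨ αB) ∨ ((γA ∨ γB) ∧ (κA ∨ κB))) ∧ ((γA ∨ γB) ∨ ((αA ∨ αB) ∧ (κA ∨ κB)))) → x = 1)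
    (hx0 : ¬ (¬ ((αA ∨ αB) ∨ ((γA ∨ γB) ∧ (κA ∨ κB))) ∧ ((γA ∨ γB) ∨ ((αA ∨ αB) ∧ (κA ∨ κB)))) → x = 0)
    (hgA1 : (¬αA ∧ γA) → gA = 1) (hgA0 : ¬ (¬αA ∧ γA) → gA = 0)
    (hgB1 : (¬αB ∧ γB) → gB = 1) (hgB0 : ¬ (¬αB ∧ γB) → gB = 0)
    (hzA1 : (¬αA ∧ ¬γA ∧ ¬κA) → zA = 1) (hzA0 : ¬ (¬αA ∧ ¬γA ∧ ¬κA) → zA = 0)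
    (hzB1 : (¬αB ∧ ¬γB ∧ ¬κB) → zB = 1) (hzB0 : ¬ (¬αB ∧ ¬γB ∧ ¬κB) → zB = 0) :
    x = gA * zB + zA * gB + gA * gB := by
  by_cases hαA : αA <;> by_cases hγA : γA <;> by_cases hκA : κA <;>
    by_cases hαB : αB <;> by_cases hγB : γB <;> by_cases hκB : κB <;> simp_all

/-- The cell `a|b|c` of the glued graph: `¬(a~b) ∧ ¬(a~c)` in the glued graph iff in both pieces. [this work] -/
theorem table_apart :
    (¬ ((αA ∨ αB) ∨ ((γA ∨ γB) ∧ (κA ∨ κB))) ∧ ¬ ((γA ∨ γB) ∨ ((αA ∨ αB) ∧ (κA ∨ κB)))) ↔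
      (¬αA ∧ ¬γA) ∧ (¬αB ∧ ¬γB) := by
  tauto

end Tables

/-! ### Pointwise: the glued cells as bilinear forms in the piece cells -/

section Cells

variable {DA DB : Finset (Sym2 V)} {a b c : V}

/-- Transitivity of one-piece connections among `a, b, c` (the three implications used by the tables),
in event form. [folklore] -/
theorem trans_three (η : BondConfig V) :
    (η ∈ {η : BondConfig V | b ∈ cl η.toFinset a} → η ∈ {η : BondConfig V | c ∈ cl η.toFinset a} →
        η ∈ {η : BondConfig V | c ∈ cl η.toFinset b}) ∧
      (η ∈ {η : BondConfig V | b ∈ cl η.toFinset a} → η ∈ {η : BondConfig V | c ∈ cl η.toFinset b} →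
        η ∈ {η : BondConfig V | c ∈ cl η.toFinset a}) ∧
      (η ∈ {η : BondConfig V | c ∈ cl η.toFinset a} → η ∈ {η : BondConfig V | c ∈ cl η.toFinset b} →
        η ∈ {η : BondConfig V | b ∈ cl η.toFinset a}) := by
  simp only [Set.mem_setOf_eq]
  exact ⟨fun h h' => mem_cl_trans (mem_cl_comm.1 h) h', fun h h' => mem_cl_trans h h',
    fun h h' => mem_cl_trans h (mem_cl_comm.1 h')⟩

/-- Join rule with the atoms `c ∈ cl · b` (instead of `b ∈ cl · c`) for `b ~ c`. [this work] -/
theorem join_ab_ac (ζA ζB : Finset (Sym2 V))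
    (hsep : ∀ v : V, (∃ e ∈ ζA, v ∈ e) → (∃ e ∈ ζB, v ∈ e) → (v = a ∨ v = b ∨ v = c))
    (ω : BondConfig V) (hω : ω.toFinset = ζA ∪ ζB) :
    (b ∈ cl ω.toFinset a ↔
      ((b ∈ cl ζA a ∨ b ∈ cl ζB a) ∨ ((c ∈ cl ζA a ∨ c ∈ cl ζB a) ∧ (c ∈ cl ζA b ∨ c ∈ cl ζB b)))) ∧
    (c ∈ cl ω.toFinset a ↔
      ((c ∈ cl ζA a ∨ c ∈ cl ζB a) ∨ ((b ∈ cl ζA a ∨ b ∈ cl ζB a) ∧ (c ∈ cl ζA b ∨ c ∈ cl ζB b)))) := by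
  rw [hω]
  refine ⟨?_, APL.glued_ac_iff _ _ a b c hsep⟩
  rw [APL.glued_ab_iff _ _ a b c hsep]
  have e1 : (b ∈ cl ζA c) = (c ∈ cl ζA b) := propext mem_cl_comm
  have e2 : (b ∈ cl ζB c) = (c ∈ cl ζB b) := propext mem_cl_comm
  rw [e1, e2]

variable (hab : a ≠ b) (hac : a ≠ c) (hbc : b ≠ c)
  (hsepD : ∀ v : V, (∃ e ∈ DA, v ∈ e) → (∃ e ∈ DB, v ∈ e) → (v = a ∨ v = b ∨ v = c))
include hsepD

/-- **Join rule for a glued configuration inside the support**, in event form: with `ζ_A = ω ∩ DA`,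
`ζ_B = ω ∖ DA` and the one-piece events `E_ab = {a ~ b}`, `E_ac = {a ~ c}`, `E_bc = {b ~ c}`,
`a ~ b` in `ω` iff `(ζ_A ∈ E_ab ∨ ζ_B ∈ E_ab) ∨ ((ζ_A ∈ E_ac ∨ ζ_B ∈ E_ac) ∧ (ζ_A ∈ E_bc ∨ ζ_B ∈ E_bc))`,
and likewise for `a ~ c`. [this work] -/
theorem glued_atoms {ω : BondConfig V} (hω : ω ⊆ ↑DA ∪ ↑DB) :
    (b ∈ cl ω.toFinset a ↔
      (((ω ∩ ↑DA) ∈ {η : BondConfig V | b ∈ cl η.toFinset a} ∨ (ω \ ↑DA) ∈ {η : BondConfig V | b ∈ cl η.toFinset a}) ∨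
        (((ω ∩ ↑DA) ∈ {η : BondConfig V | c ∈ cl η.toFinset a} ∨ (ω \ ↑DA) ∈ {η : BondConfig V | c ∈ cl η.toFinset a}) ∧
          ((ω ∩ ↑DA) ∈ {η : BondConfig V | c ∈ cl η.toFinset b} ∨ (ω \ ↑DA) ∈ {η : BondConfig V | c ∈ cl η.toFinset b})))) ∧
    (c ∈ cl ω.toFinset a ↔
      (((ω ∩ ↑DA) ∈ {η : BondConfig V | c ∈ cl η.toFinset a} ∨ (ω \ ↑DA) ∈ {η : BondConfig V | c ∈ cl η.toFinset a}) ∨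
        (((ω ∩ ↑DA) ∈ {η : BondConfig V | b ∈ cl η.toFinset a} ∨ (ω \ ↑DA) ∈ {η : BondConfig V | b ∈ cl η.toFinset a}) ∧
          ((ω ∩ ↑DA) ∈ {η : BondConfig V | c ∈ cl η.toFinset b} ∨ (ω \ ↑DA) ∈ {η : BondConfig V | c ∈ cl η.toFinset b})))) := by
  simp only [Set.mem_setOf_eq]
  refine join_ab_ac _ _ ?_ ω ?_
  · rintro v ⟨e, he, hve⟩ ⟨e', he', hve'⟩
    rw [mem_toFinset'] at he he'
    have he'B : e' ∈ DB := by
      rcases hω he'.1 with h' | h'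
      · exact absurd h' he'.2
      · exact h'
    exact hsepD v ⟨e, he.2, hve⟩ ⟨e', he'B, hve'⟩
  · ext e
    simp only [Finset.mem_union, mem_toFinset', Set.mem_inter_iff, Set.mem_sdiff, Finset.mem_coe]
    tauto

/-- **Join rule for `b ~ c` in a glued configuration inside the support**, in event form (`APL.glued_bc_iff`):
`c ∈ cl ω b ↔ (ζ_A ∈ E_bc ∨ ζ_B ∈ E_bc) ∨ ((ζ_A ∈ E_ab ∨ ζ_B ∈ E_ab) ∧ (ζ_A ∈ E_ac ∨ ζ_B ∈ E_ac))`. [this work] -/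
theorem glued_atom_bc {ω : BondConfig V} (hω : ω ⊆ ↑DA ∪ ↑DB) :
    c ∈ cl ω.toFinset b ↔
      (((ω ∩ ↑DA) ∈ {η : BondConfig V | c ∈ cl η.toFinset b} ∨ (ω \ ↑DA) ∈ {η : BondConfig V | c ∈ cl η.toFinset b}) ∨
        (((ω ∩ ↑DA) ∈ {η : BondConfig V | b ∈ cl η.toFinset a} ∨ (ω \ ↑DA) ∈ {η : BondConfig V | b ∈ cl η.toFinset a}) ∧
          ((ω ∩ ↑DA) ∈ {η : BondConfig V | c ∈ cl η.toFinset a} ∨ (ω \ ↑DA) ∈ {η : BondConfig V | c ∈ cl η.toFinset a}))) := by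
  simp only [Set.mem_setOf_eq]
  suffices key : ∀ ζA ζB : Finset (Sym2 V), ω.toFinset = ζA ∪ ζB →
      (∀ v : V, (∃ e ∈ ζA, v ∈ e) → (∃ e ∈ ζB, v ∈ e) → (v = a ∨ v = b ∨ v = c)) →
      (c ∈ cl ω.toFinset b ↔ ((c ∈ cl ζA b ∨ c ∈ cl ζB b) ∨
        ((b ∈ cl ζA a ∨ b ∈ cl ζB a) ∧ (c ∈ cl ζA a ∨ c ∈ cl ζB a)))) by
    refine key _ _ ?_ ?_
    · ext e
      simp only [Finset.mem_union, mem_toFinset', Set.mem_inter_iff, Set.mem_sdiff, Finset.mem_coe]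
      tauto
    · rintro v ⟨e, he, hve⟩ ⟨e', he', hve'⟩
      rw [mem_toFinset'] at he he'
      have he'B : e' ∈ DB := by
        rcases hω he'.1 with h' | h'
        · exact absurd h' he'.2
        · exact h'
      exact hsepD v ⟨e, he.2, hve⟩ ⟨e', he'B, hve'⟩
  intro ζA ζB hωζ hsep
  rw [hωζ]
  exact APL.glued_bc_iff _ _ a b c hsep

set_option maxHeartbeats 400000 in
include hab in
/-- **Separating cell of a glued configuration inside the support**, in event form: `ω` lies in the cell
`S = {b, c ∉ C(a), C(a) meets every b–c path of D_A ∪ D_B}` iff its two blocks lie in the corresponding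
cells of the pieces (`ThreeSum.sep_union_iff` + the join rule). [this work] -/
theorem glued_S_iff {ω : BondConfig V} (hω : ω ⊆ ↑DA ∪ ↑DB) :
    ω ∈ {η : BondConfig V | b ∉ cl η.toFinset a ∧ c ∉ cl η.toFinset a ∧ Sep (DA ∪ DB) (cl η.toFinset a) b c} ↔
      ((ω ∩ ↑DA) ∈ {η : BondConfig V | b ∉ cl η.toFinset a ∧ c ∉ cl η.toFinset a ∧ Sep DA (cl η.toFinset a) b c} ∧
        (ω \ ↑DA) ∈ {η : BondConfig V | b ∉ cl η.toFinset a ∧ c ∉ cl η.toFinset a ∧ Sep DB (cl η.toFinset a) b c}) := by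
  obtain ⟨jab, jac⟩ := glued_atoms (a := a) (b := b) (c := c) hsepD hω
  simp only [Set.mem_setOf_eq] at jab jac ⊢
  -- the blocks as finite sets, read off from the goal
  suffices key : ∀ ζA ζB : Finset (Sym2 V), ω.toFinset = ζA ∪ ζB → ζA ⊆ DA → ζB ⊆ DB →
      (b ∈ cl ω.toFinset a ↔ ((b ∈ cl ζA a ∨ b ∈ cl ζB a) ∨
        ((c ∈ cl ζA a ∨ c ∈ cl ζB a) ∧ (c ∈ cl ζA b ∨ c ∈ cl ζB b)))) →
      (c ∈ cl ω.toFinset a ↔ ((c ∈ cl ζA a ∨ c ∈ cl ζB a) ∨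
        ((b ∈ cl ζA a ∨ b ∈ cl ζB a) ∧ (c ∈ cl ζA b ∨ c ∈ cl ζB b)))) →
      ((b ∉ cl ω.toFinset a ∧ c ∉ cl ω.toFinset a ∧ Sep (DA ∪ DB) (cl ω.toFinset a) b c) ↔
        ((b ∉ cl ζA a ∧ c ∉ cl ζA a ∧ Sep DA (cl ζA a) b c) ∧
          (b ∉ cl ζB a ∧ c ∉ cl ζB a ∧ Sep DB (cl ζB a) b c))) by
    refine key _ _ ?_ ?_ ?_ jab jac
    · ext e
      simp only [Finset.mem_union, mem_toFinset', Set.mem_inter_iff, Set.mem_sdiff, Finset.mem_coe]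
      tauto
    · intro e he; rw [mem_toFinset'] at he; exact he.2
    · intro e he; rw [mem_toFinset'] at he
      rcases hω he.1 with h' | h'
      · exact absurd h' he.2
      · exact h'
  intro ζA ζB hωζ hζA hζB jab' jac'
  constructor
  · rintro ⟨hb, hc, hS⟩
    have hbA : b ∉ cl ζA a := fun h => hb (jab'.2 (Or.inl (Or.inl h)))
    have hbB : b ∉ cl ζB a := fun h => hb (jab'.2 (Or.inl (Or.inr h)))
    have hcA : c ∉ cl ζA a := fun h => hc (jac'.2 (Or.inl (Or.inl h)))
    have hcB : c ∉ cl ζB a := fun h => hc (jac'.2 (Or.inl (Or.inr h)))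
    rw [hωζ, sep_union_iff hsepD hζA hζB hab hbA hcA hbB hcB] at hS
    exact ⟨⟨hbA, hcA, hS.1⟩, ⟨hbB, hcB, hS.2⟩⟩
  · rintro ⟨⟨hbA, hcA, hSA⟩, ⟨hbB, hcB, hSB⟩⟩
    have hb : b ∉ cl ω.toFinset a := fun h => by
      rcases jab'.1 h with (h' | h') | ⟨h' | h', _⟩
      · exact hbA h'
      · exact hbB h'
      · exact hcA h'
      · exact hcB h'
    have hc : c ∉ cl ω.toFinset a := fun h => by
      rcases jac'.1 h with (h' | h') | ⟨h' | h', _⟩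
      · exact hcA h'
      · exact hcB h'
      · exact hbA h'
      · exact hbB h'
    refine ⟨hb, hc, ?_⟩
    rw [hωζ, sep_union_iff hsepD hζA hζB hab hbA hcA hbB hcB]
    exact ⟨hSA, hSB⟩

omit hsepD in
/-- Inside the support, the whole configuration (as a finite set) lies in `DA ∪ DB`. [folklore] -/
theorem toFinset_subset_of_subset {ω : BondConfig V} (hω : ω ⊆ ↑DA ∪ ↑DB) : ω.toFinset ⊆ DA ∪ DB := by
  intro e he
  rw [mem_toFinset'] at he
  simpa [Finset.mem_union] using hω he

end Cells

end ThreeSum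

end Summit.CriticalPhenomena.PercolationContinuityZ3.Theorems
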